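import Summits.QuantumFields.YangMills.Theorems.BalabanUVNodesN07WOfRecordTraceSectors
import Summits.QuantumFields.YangMills.Theorems.BalabanUVNodesN07FrakAOfRecordTraceSectors
import Summits.QuantumFields.YangMills.Theorems.BalabanUVNodesN07WOfRecordRealSlice
import Summits.QuantumFields.YangMills.Theorems.BalabanUVNodesN07SchemeTokBundleOfRecord
import Literature.MathematicalPhysics.QuantumFieldTheory.Balaban1983to89.Node00.BgSchemeChartLie
import HarnessLib

/-!
# NODE N07 — ASSEMBLY AT `N = 2`: THE LIE TOKEN «`iX(b) ∈ 𝔰𝔲(2)`» OF THE [15] PROP. 6 CHART OF RECORD FROM PROP. 6's REGIME AND THE DISPLAYED SECT. C ROWS —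
# ✓`Node00.BgSchemeChartLie.lieTokAt_of_rows` INSTANTIATED at ✓`Node00.bgSchemeOfRecord … U₀ …` with `TY := evHerm0`, `TZ :=` the Hermitian traceless currents, every ROW supplied by
# the reality (g26) and trace (g27) halves of this seat: `𝒢` (✓p822030 + ✓p824006), `W` (✓p822996 + ✓`trace_WOfRecordAt_eq_zero_two`), `J` (✓`JOfRecordAtBg_mem_herm0`),
# `𝔄` (✓p822030 + ✓p824643); hence `ChartSUTok` on the domain and def-Y's bundle `SchemeTokOfRecord` FROM `RegimeTok` ([15] Prop. 6 p. 295, (15) p. 280, (51) p. 286; [B9] (3.134))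

Cell `pub-ymgap`, width seat `pub-ymgap-dag-n07-w3` (g27), CLAIM-6.  `--kind proof --supports stmt-QuantumFields-27238 --as helper`; count-neutral.
[15] = [Balaban1985Variational]; [B9] = [Balaban1985BackgroundPropagators].

CONTENTS (`S := bgSchemeOfRecord F 2 K k Ω U₀ dom levB G′ Δ2 a hposπ hpos♭ hQ ε_C B₀ C₄ a₃ j a𝔄 ε₄`).
* §1 bridges: `conjJet_eq_self_iff` ∕ `conjNeg_eq_self_iff` (the conjugation-fixed jets ∕ currents are the bondwise Hermitian ones), `mem_evHerm0_ofRecord_iff` (`Y ∈ S.evHerm0` iff the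
  presented field of `Y` is Hermitian and traceless on every bond — `S.ev = η·evLit`, `η > 0`).
* §2 ★★★ `lieTokAt_bgSchemeOfRecord_two` — at one field `V`: Prop. 6's regime at `V` (`Regime`, `‖J‖ ≤ j`, `‖𝔄 V‖ < a`), the guard, the data rows (`G′`, `Δ⁽²⁾` real and commuting
  with the scalar part), Sect. C's rows for `W` (`Regime H♭ 0 C^{𝔰𝔩} …`, `Prop4Hyp`, `hCreal`, `hCtr`, `a₃ ≤ a_C`) and the (20)-smallness of `V(c)Ū(c)⋆` GIVE `S.LieTokAt V`.
* §3 ★★★ `chartSUTok_bgSchemeOfRecord_two` (`RegimeTok` + the rows uniformly on `dom` ⟹ `ChartSUTok`), ★★★ `schemeTokOfRecord_two_of_regimeTok` (with `Delta2Tok ∧ Delta2SymmTok` for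
  `Δ2` — then `Δ2` is real by ✓`realConj_delta2_eq_self` — def-Y's bundle `SchemeTokOfRecord` follows from `RegimeTok` and the displayed rows: ✓`schemeTokOfRecord_of_regimeTok_of_chartSUTok`).

HONEST LABELS.  Assembly of cited tree facts; EVERY estimate of Bałaban stays DISPLAYED (Prop. 6's regime ∕ `RegimeTok` = (117)–(121) with [B9] Thm 3.13's `B₀`; Sect. C's regime and
`Prop4Hyp` for `W`; `hCreal`∕`hCtr` = the small-field matching of ✓`…COfRecordRealSliceNhds` ∕ ✓`…CslOfRecordTraceSectors` with Sect. C's radii; the data rows; the domain smallness);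
an `N = 2` statement.  Count-neutral; N07 NOT discharged; P0 ⟨26900⟩ OPEN; R4 is the conditional finite-𝕋⁴ rung only.  Nothing here is a claim about the Yang–Mills mass gap
(`Summit.QuantumFields`): finite torus, fixed `ε`; nothing continuum ∕ OS ∕ Clay.
-/

set_option autoImplicit false

noncomputable section

open scoped Matrix Matrix.Norms.L2Operator InnerProductSpace ComplexConjugate BigOperators Topology

namespace Summit.QuantumFields.YangMills.Theorems.N07LieTokAtOfRecordTwo

open Filter Metric
open Literature.MathematicalPhysics.QuantumFieldTheory.Balaban1983to89
open Literature.MathematicalPhysics.QuantumFieldTheory.Balaban1983to89.T4Continuum (T4Family)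
open T4Continuum BlockAveraging
open B9SectCLatticeCarrier (Bond)
open B9Eq311L2Pairing (WL2)
open B9Eq311TracePairing (starW)
open B9Eq3119DeltaPiReality (realConj_eq_self_iff)
open B9AdOrthogonal (herm0 mem_herm0)
open B11Eq103H1Complex (SiteL2K BondL2K)
open B11Eq111FrakG (nabla115)
open B11Eq115Space (NegSize NegSup levWeight JetSup)
open B11Eq174Chart (Regime)
open B11Prop6Scheme (Prop4Hyp)
open Node00
open Summit.QuantumFields.YangMills.Theorems.N07TraceSectorDefs (scalPartW)
open Summit.QuantumFields.YangMills.Theorems.N07FrakGOfRecordReality (equiv_frakGOfRecordAtBg128_star equiv_frakAOfRecordAtBg128_star)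
open Summit.QuantumFields.YangMills.Theorems.N07SlotCTraceSectors (trace_equiv_frakGOfRecordAtBg128_eq_zero_two)
open Summit.QuantumFields.YangMills.Theorems.N07FrakAOfRecordTraceSectors (trace_equiv_frakAOfRecordAtBg128_eq_zero_two)
open Summit.QuantumFields.YangMills.Theorems.N07WOfRecordRealSlice (WOfRecordAt_herm)
open Summit.QuantumFields.YangMills.Theorems.N07WOfRecordTraceSectors (trace_WOfRecordAt_eq_zero_two)
open Summit.QuantumFields.YangMills.Theorems.N07CurvFormTraceSU2 (JOfRecordAtBg_mem_herm0)
open Summit.QuantumFields.YangMills.Theorems.N07QuadPartReality (realConj_delta2_eq_self)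
open Summit.QuantumFields.YangMills.Theorems.N07SchemeTokBundleOfRecord (schemeTokOfRecord_of_regimeTok_of_chartSUTok)

/-! ## §1  Bridges: conjugation-fixed = bondwise Hermitian; the real sector of the scheme of record -/

section Bridges

variable (F : T4Family) (N : ℕ) (K : ℕ) (k : ℕ) (Ω : ℕ → Set (Site (F.P K) 0)) (U₀ : GaugeField (F.P K) 0 (SU N))

/-- A jet is fixed by the bondwise conjugation iff its presented field is Hermitian at every bond. [cite: Balaban1985Variational, (115) p.294 (bookkeeping)] -/
theorem conjJet_eq_self_iff [Fact (0 < (F.L : ℝ))] [Fact (0 < (F.P K).eta k)] (Y : Space115Lit F N K k Ω U₀) :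
    ((JetSup.equiv _ _ (nabla115 ((F.P K).eta k) (unitsOfRecord F N U₀))).symm
        (star (JetSup.equiv _ _ (nabla115 ((F.P K).eta k) (unitsOfRecord F N U₀)) Y)) : Space115Lit F N K k Ω U₀) = Y ↔
      ∀ b, star (JetSup.equiv _ _ (nabla115 ((F.P K).eta k) (unitsOfRecord F N U₀)) Y b) = JetSup.equiv _ _ (nabla115 ((F.P K).eta k) (unitsOfRecord F N U₀)) Y b := by
  constructor
  · intro h b
    have hb := congrArg (fun B : Space115Lit F N K k Ω U₀ => JetSup.equiv _ _ (nabla115 ((F.P K).eta k) (unitsOfRecord F N U₀)) B b) h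
    simpa only [Equiv.apply_symm_apply, Pi.star_apply] using hb
  · intro h
    apply (JetSup.equiv _ _ (nabla115 ((F.P K).eta k) (unitsOfRecord F N U₀))).injective
    rw [Equiv.apply_symm_apply]
    funext b
    rw [Pi.star_apply, h b]

/-- A current is fixed by the bondwise conjugation iff it is Hermitian at every bond. [cite: Balaban1985Variational, (27) p.282 (bookkeeping)] -/
theorem conjNeg_eq_self_iff [Fact (0 < (F.L : ℝ))] [Fact (0 < (F.P K).eta k)] (f : NegSizeLit F N K k Ω 3) :
    ((NegSup.equiv _ _).symm (star (NegSup.equiv (levWeight (F.L : ℝ) ((F.P K).eta k) (bondLevLit F Ω k) 3) (Matrix (Fin N) (Fin N) ℂ) f)) : NegSizeLit F N K k Ω 3) = f ↔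
      ∀ b, star (NegSup.equiv (levWeight (F.L : ℝ) ((F.P K).eta k) (bondLevLit F Ω k) 3) (Matrix (Fin N) (Fin N) ℂ) f b) =
        NegSup.equiv (levWeight (F.L : ℝ) ((F.P K).eta k) (bondLevLit F Ω k) 3) (Matrix (Fin N) (Fin N) ℂ) f b := by
  constructor
  · intro h b
    have hb := congrArg (fun g : NegSizeLit F N K k Ω 3 => NegSup.equiv (levWeight (F.L : ℝ) ((F.P K).eta k) (bondLevLit F Ω k) 3) (Matrix (Fin N) (Fin N) ℂ) g b) h
    simpa only [Equiv.apply_symm_apply, Pi.star_apply] using hb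
  · intro h
    apply (NegSup.equiv (levWeight (F.L : ℝ) ((F.P K).eta k) (bondLevLit F Ω k) 3) (Matrix (Fin N) (Fin N) ℂ)).injective
    rw [Equiv.apply_symm_apply]
    funext b
    rw [Pi.star_apply, h b]

variable {N} in
/-- `(η·M) ∈ herm0 ⟺ M ∈ herm0` for a nonzero real `η` (a real submodule). [cite: Balaban1985Variational, (19) p.281 (bookkeeping)] -/
theorem smul_mem_herm0_iff {η : ℝ} (hη : η ≠ 0) (M : Matrix (Fin N) (Fin N) ℂ) : ((η : ℂ)) • M ∈ herm0 (Fin N) ↔ M ∈ herm0 (Fin N) := by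
  rw [Complex.coe_smul]
  constructor
  · intro h
    have h' := (herm0 (Fin N)).smul_mem η⁻¹ h
    rwa [smul_smul, inv_mul_cancel₀ hη, one_smul] at h'
  · intro h
    exact (herm0 (Fin N)).smul_mem η h

variable [NeZero N] [Fact (0 < (F.L : ℝ))] [Fact (0 < (F.P K).eta k)] [Fact (0 < c0Rec F K k)] [Fact (∀ c, 0 < wBRec F K k c)]
  (dom : Set (GaugeField (F.P K) k (SU N))) (levB : PBond (F.P K) k → ℕ)
  (Gp : SiteL2K ℂ (F.P K).d (fun _ => (F.P K).sitesPerDir 0) (c0Rec F K k) (WRec N) →ₗ[ℂ]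
    SiteL2K ℂ (F.P K).d (fun _ => (F.P K).sitesPerDir 0) (c0Rec F K k) (WRec N))
  (Δ2 : BondL2K ℂ (F.P K).d (fun _ => (F.P K).sitesPerDir 0) (c0Rec F K k) (WRec N) →ₗ[ℂ]
    BondL2K ℂ (F.P K).d (fun _ => (F.P K).sitesPerDir 0) (c0Rec F K k) (WRec N)) (a : ℝ)
  (hposπ : ∀ x, x ≠ 0 → 0 < RCLike.re ⟪x, laplaceAOfRecordAt F N k U₀ (hessOpOfRecord128 F N k U₀ Gp (QflatOfRecord F N k) Δ2)
    (QOfRecord F N k U₀) (QflatOfRecord F N k) a x⟫_ℂ)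
  (hposb : ∀ x, x ≠ 0 → 0 < RCLike.re ⟪x, laplaceAOfRecord F N k U₀ (QOfRecord F N k U₀) (QflatOfRecord F N k) a x⟫_ℂ)
  (hQ : Function.Surjective (QOfRecord F N k U₀)) (εC B₀ C₄ a₃ j a𝔄 ε₄ : ℝ)

/-- **THE REAL SECTOR OF THE SCHEME OF RECORD, READ ON THE JETS**: `Y ∈ S.evHerm0` iff the presented field of `Y` is HERMITIAN and TRACELESS at every bond (`S.ev = η·evLit`, `η > 0`;
`evLit Y c = Y(bondToLit c)`). [cite: Balaban1985Variational, (19) p.281, (51) p.286, (115) p.294] -/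
theorem mem_evHerm0_ofRecord_iff (Y : Space115Lit F N K k Ω U₀) :
    Y ∈ (bgSchemeOfRecord F N K k Ω U₀ dom levB Gp Δ2 a hposπ hposb hQ εC B₀ C₄ a₃ j a𝔄 ε₄).evHerm0 ↔
      ((JetSup.equiv _ _ (nabla115 ((F.P K).eta k) (unitsOfRecord F N U₀))).symm
          (star (JetSup.equiv _ _ (nabla115 ((F.P K).eta k) (unitsOfRecord F N U₀)) Y)) : Space115Lit F N K k Ω U₀) = Y ∧
        ∀ b, (JetSup.equiv _ _ (nabla115 ((F.P K).eta k) (unitsOfRecord F N U₀)) Y b).trace = 0 := by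
  have hη : ((F.P K).eta k : ℝ) ≠ 0 := (Fact.out : 0 < (F.P K).eta k).ne'
  rw [BgScheme.mem_evHerm0_iff, conjJet_eq_self_iff, bgSchemeOfRecord_ev]
  simp only [LinearMap.smul_apply, Pi.smul_apply, evLit_apply, smul_mem_herm0_iff hη, mem_herm0]
  constructor
  · intro h
    refine ⟨fun b => ?_, fun b => ?_⟩
    · have h1 := (h ((bondToLit (F.P K) 0).symm b)).1
      rw [Equiv.apply_symm_apply] at h1
      rw [Matrix.star_eq_conjTranspose]; exact h1
    · have h2 := (h ((bondToLit (F.P K) 0).symm b)).2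
      rwa [Equiv.apply_symm_apply] at h2
  · rintro ⟨h1, h2⟩ c
    refine ⟨?_, h2 _⟩
    have := h1 (bondToLit (F.P K) 0 c)
    rw [Matrix.star_eq_conjTranspose] at this
    exact this

end Bridges

/-! ## §2  The Lie token at one field, `N = 2` -/

section Two

variable (F : T4Family) (K : ℕ) (k : ℕ) (Ω : ℕ → Set (Site (F.P K) 0)) (U₀ : GaugeField (F.P K) 0 (SU 2))
  [Fact (0 < (F.L : ℝ))] [Fact (0 < (F.P K).eta k)] [Fact (0 < c0Rec F K k)] [Fact (∀ c, 0 < wBRec F K k c)]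
  (dom : Set (GaugeField (F.P K) k (SU 2))) (levB : PBond (F.P K) k → ℕ)
  {Gp : SiteL2K ℂ (F.P K).d (fun _ => (F.P K).sitesPerDir 0) (c0Rec F K k) (WRec 2) →ₗ[ℂ]
    SiteL2K ℂ (F.P K).d (fun _ => (F.P K).sitesPerDir 0) (c0Rec F K k) (WRec 2)}
  {Δ2 : BondL2K ℂ (F.P K).d (fun _ => (F.P K).sitesPerDir 0) (c0Rec F K k) (WRec 2) →ₗ[ℂ]
    BondL2K ℂ (F.P K).d (fun _ => (F.P K).sitesPerDir 0) (c0Rec F K k) (WRec 2)} (a : ℝ)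
  (hposπ : ∀ x, x ≠ 0 → 0 < RCLike.re ⟪x, laplaceAOfRecordAt F 2 k U₀ (hessOpOfRecord128 F 2 k U₀ Gp (QflatOfRecord F 2 k) Δ2)
    (QOfRecord F 2 k U₀) (QflatOfRecord F 2 k) a x⟫_ℂ)
  (hposb : ∀ x, x ≠ 0 → 0 < RCLike.re ⟪x, laplaceAOfRecord F 2 k U₀ (QOfRecord F 2 k U₀) (QflatOfRecord F 2 k) a x⟫_ℂ)
  (hQ : Function.Surjective (QOfRecord F 2 k U₀)) (εC B₀ C₄ a₃ j a𝔄 ε₄ : ℝ) {b C₂ c₄ aC : ℝ}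
  (RC : Regime (H1OfRecordAtBgFlat F 2 K k Ω U₀ levB a hposb hQ) 0 (CslOfRecord F 2 K k Ω U₀ levB) b 0 C₂ c₄ 0 aC εC)
  (hCreal : ∀ A : Space115Lit F 2 K k Ω U₀,
    ((JetSup.equiv _ _ (nabla115 ((F.P K).eta k) (unitsOfRecord F 2 U₀))).symm
        (star (JetSup.equiv _ _ (nabla115 ((F.P K).eta k) (unitsOfRecord F 2 U₀)) A)) : Space115Lit F 2 K k Ω U₀) = A →
    ‖A‖ ≤ εC + aC → ((NegSup.equiv _ _).symm (star (NegSup.equiv _ _ (CslOfRecord F 2 K k Ω U₀ levB A))) :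
      NegSize (F.L : ℝ) ((F.P K).eta k) levB 0 (Matrix (Fin 2) (Fin 2) ℂ)) = CslOfRecord F 2 K k Ω U₀ levB A)
  (hCtr : ∀ A : Space115Lit F 2 K k Ω U₀,
    ((JetSup.equiv _ _ (nabla115 ((F.P K).eta k) (unitsOfRecord F 2 U₀))).symm
        (star (JetSup.equiv _ _ (nabla115 ((F.P K).eta k) (unitsOfRecord F 2 U₀)) A)) : Space115Lit F 2 K k Ω U₀) = A →
    (∀ b, (JetSup.equiv _ _ (nabla115 ((F.P K).eta k) (unitsOfRecord F 2 U₀)) A b).trace = 0) →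
    ‖A‖ ≤ εC + aC → ∀ c, (NegSup.equiv _ _ (CslOfRecord F 2 K k Ω U₀ levB A) c).trace = 0)

include RC hCreal hCtr in
set_option maxHeartbeats 1600000 in
/-- ★★★ **THE LIE TOKEN OF THE PROP. 6 CHART OF RECORD AT `N = 2`**: at a field `V` where Prop. 6's regime holds for the scheme of record (`Regime (𝒢 V) 0 (W V) B₀ 0 C₄ a₃ j a ε₄`, `‖J‖ ≤ j`,
`‖𝔄 V‖ < a`), under the guard, the data rows (`G′`, `Δ⁽²⁾` real and commuting with the scalar part), Sect. C's rows for `W` (`Regime H♭ 0 C^{𝔰𝔩} …` with `a₃ ≤ a_C`, `Prop4Hyp`, `hCreal`, `hCtr`)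
and the (20)-smallness `‖V(c)Ū(c)⋆ − 1‖ ≤ 1/4`: the exponent `i·X(b)`, `X = ev(𝒜(V) + 𝔄(V))`, lies in `𝔰𝔲(2)` on EVERY bond — ✓`Node00.BgSchemeChartLie.lieTokAt_of_rows` with `TY := evHerm0` and
`TZ :=` the Hermitian traceless currents, its four ROWS supplied by ✓p822030∕✓p824006 (`𝒢`), ✓p822996∕✓`trace_WOfRecordAt_eq_zero_two` (`W`), ✓`JOfRecordAtBg_mem_herm0` (`J`),
✓p822030∕✓p824643 (`𝔄`). [cite: Balaban1985Variational, Prop. 6 (115)–(121) p.295, (15) p.280, (51) p.286, (20) p.281] -/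
theorem lieTokAt_bgSchemeOfRecord_two (h : SmallBelow (avOfRecord F 2 K) k U₀)
    (hGpR : ∀ s, Gp (starW (phiRec 2) s) = starW (phiRec 2) (Gp s)) (hGpS : ∀ s, Gp (scalPartW 2 _ s) = scalPartW 2 _ (Gp s))
    (hΔ2R : ∀ x, Δ2 (starW (phiRec 2) x) = starW (phiRec 2) (Δ2 x)) (hΔ2S : ∀ x, Δ2 (scalPartW 2 _ x) = scalPartW 2 _ (Δ2 x))
    (hP : Prop4Hyp (CslOfRecord F 2 K k Ω U₀ levB) C₂ c₄) (haC : a₃ ≤ aC) {V : GaugeField (F.P K) k (SU 2)}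
    (R : Regime ((bgSchemeOfRecord F 2 K k Ω U₀ dom levB Gp Δ2 a hposπ hposb hQ εC B₀ C₄ a₃ j a𝔄 ε₄).𝒢 V) 0
      ((bgSchemeOfRecord F 2 K k Ω U₀ dom levB Gp Δ2 a hposπ hposb hQ εC B₀ C₄ a₃ j a𝔄 ε₄).W V) B₀ 0 C₄ a₃ j a𝔄 ε₄)
    (hJ : ‖(bgSchemeOfRecord F 2 K k Ω U₀ dom levB Gp Δ2 a hposπ hposb hQ εC B₀ C₄ a₃ j a𝔄 ε₄).J V‖ ≤ j)
    (h𝔄 : ‖(bgSchemeOfRecord F 2 K k Ω U₀ dom levB Gp Δ2 a hposπ hposb hQ εC B₀ C₄ a₃ j a𝔄 ε₄).𝔄 V‖ < a𝔄)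
    (hV : ∀ c, ‖(V c : Matrix (Fin 2) (Fin 2) ℂ) * star (Averaging.iter (avOfRecord F 2 K) k U₀ c : Matrix (Fin 2) (Fin 2) ℂ) - 1‖ ≤ 1 / 4) :
    (bgSchemeOfRecord F 2 K k Ω U₀ dom levB Gp Δ2 a hposπ hposb hQ εC B₀ C₄ a₃ j a𝔄 ε₄).LieTokAt V := by
  -- the real sector of currents: Hermitian and traceless at every bond (a real submodule for the `ℝ`-structure restricted from `ℂ`, the one the scheme's rows use)
  let TZ : @Submodule ℝ (NegSizeLit F 2 K k Ω 3) _ _ NormedSpace.complexToReal.toModule :=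
    { carrier := {f | ∀ b', NegSup.equiv (levWeight (F.L : ℝ) ((F.P K).eta k) (bondLevLit F Ω k) 3) (Matrix (Fin 2) (Fin 2) ℂ) f b' ∈ herm0 (Fin 2)}
      add_mem' := fun {f g} hf hg b' => by
        rw [NegSup.equiv_add, Pi.add_apply]
        exact add_mem (hf b') (hg b')
      zero_mem' := fun b' => by
        rw [NegSup.equiv_zero, Pi.zero_apply]
        exact zero_mem _
      smul_mem' := fun r f hf b' => by
        show NegSup.equiv (levWeight (F.L : ℝ) ((F.P K).eta k) (bondLevLit F Ω k) 3) (Matrix (Fin 2) (Fin 2) ℂ) (((r : ℂ)) • f) b' ∈ herm0 (Fin 2)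
        rw [NegSup.equiv_smul, Pi.smul_apply, Complex.coe_smul]
        exact (herm0 (Fin 2)).smul_mem r (hf b') }
  have memTZ : ∀ f : NegSizeLit F 2 K k Ω 3, f ∈ TZ ↔
      ∀ b', NegSup.equiv (levWeight (F.L : ℝ) ((F.P K).eta k) (bondLevLit F Ω k) 3) (Matrix (Fin 2) (Fin 2) ℂ) f b' ∈ herm0 (Fin 2) := fun f => Iff.rfl
  refine BgScheme.lieTokAt_of_rows (S := bgSchemeOfRecord F 2 K k Ω U₀ dom levB Gp Δ2 a hposπ hposb hQ εC B₀ C₄ a₃ j a𝔄 ε₄) R hJ h𝔄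
    BgScheme.isClosed_evHerm0 TZ (fun f hf => ?_) (fun X hX hXn => ?_) ?_ ?_
  · -- the `𝒢`-row
    rw [mem_evHerm0_ofRecord_iff]
    have hf' := (memTZ f).1 hf
    have hfR : ((NegSup.equiv _ _).symm (star (NegSup.equiv (levWeight (F.L : ℝ) ((F.P K).eta k) (bondLevLit F Ω k) 3) (Matrix (Fin 2) (Fin 2) ℂ) f)) :
        NegSizeLit F 2 K k Ω 3) = f :=
      (conjNeg_eq_self_iff F 2 K k Ω f).2 fun b' => by rw [Matrix.star_eq_conjTranspose]; exact ((mem_herm0.1 (hf' b')).1)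
    have hfT : ∀ b', (NegSup.equiv (levWeight (F.L : ℝ) ((F.P K).eta k) (bondLevLit F Ω k) 3) (Matrix (Fin 2) (Fin 2) ℂ) f b').trace = 0 :=
      fun b' => (mem_herm0.1 (hf' b')).2
    refine ⟨(conjJet_eq_self_iff F 2 K k Ω U₀ _).2 fun b' => ?_, fun b' => ?_⟩
    · have hs := equiv_frakGOfRecordAtBg128_star F 2 k U₀ Ω hposπ h hGpR hΔ2R hQ f b'
      rw [hfR] at hs
      rw [bgSchemeOfRecord_𝒢]
      exact hs.symm
    · rw [bgSchemeOfRecord_𝒢]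
      exact trace_equiv_frakGOfRecordAtBg128_eq_zero_two F k U₀ Ω h hGpS hΔ2S hposπ hQ hfT b'
  · -- the `W`-row
    obtain ⟨hXR, hXT⟩ := (mem_evHerm0_ofRecord_iff F 2 K k Ω U₀ dom levB Gp Δ2 a hposπ hposb hQ εC B₀ C₄ a₃ j a𝔄 ε₄ X).1 hX
    have hn : ‖X‖ < aC := lt_of_lt_of_le hXn haC
    rw [memTZ]
    intro b'
    rw [mem_herm0, bgSchemeOfRecord_W]
    refine ⟨?_, trace_WOfRecordAt_eq_zero_two F K k Ω U₀ hposb hQ levB RC hCreal hCtr h hP hGpS hXR hXT hn b'⟩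
    have hW := (conjNeg_eq_self_iff F 2 K k Ω _).1 (WOfRecordAt_herm F 2 K k Ω U₀ hposb hQ levB RC hCreal h hP hGpR hXR hn) b'
    rw [Matrix.star_eq_conjTranspose] at hW
    exact hW
  · -- the `J`-row
    rw [memTZ]
    intro b'
    rw [bgSchemeOfRecord_J]
    exact JOfRecordAtBg_mem_herm0 F K k Ω U₀ b'
  · -- the `𝔄`-row
    rw [mem_evHerm0_ofRecord_iff, bgSchemeOfRecord_𝔄]
    exact ⟨(conjJet_eq_self_iff F 2 K k Ω U₀ _).2 fun b' => equiv_frakAOfRecordAtBg128_star F 2 k U₀ Ω hposπ levB h hGpR hΔ2R hQ V hV b',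
      fun b' => trace_equiv_frakAOfRecordAtBg128_eq_zero_two F k U₀ Ω hposπ levB h hGpS hΔ2S hQ V hV b'⟩

/-! ## §3  On the domain: `ChartSUTok`, and def-Y's bundle from `RegimeTok` -/

include RC hCreal hCtr in
set_option maxHeartbeats 1600000 in
/-- ★★★ **`RegimeTok` + THE DISPLAYED ROWS ⟹ `ChartSUTok` AT `N = 2`**: the exponent `exp(iX(b))` of the chart of record is `SU(2)`-valued on every bond for every `V ∈ dom` (the rows as in
`lieTokAt_bgSchemeOfRecord_two`, the (20)-smallness uniformly on `dom`; ✓`chartSUTok_of_lieTokAt`). [cite: Balaban1985Variational, Prop. 6 p.295, (15) p.280, (7) p.279] -/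
theorem chartSUTok_bgSchemeOfRecord_two (h : SmallBelow (avOfRecord F 2 K) k U₀)
    (hGpR : ∀ s, Gp (starW (phiRec 2) s) = starW (phiRec 2) (Gp s)) (hGpS : ∀ s, Gp (scalPartW 2 _ s) = scalPartW 2 _ (Gp s))
    (hΔ2R : ∀ x, Δ2 (starW (phiRec 2) x) = starW (phiRec 2) (Δ2 x)) (hΔ2S : ∀ x, Δ2 (scalPartW 2 _ x) = scalPartW 2 _ (Δ2 x))
    (hP : Prop4Hyp (CslOfRecord F 2 K k Ω U₀ levB) C₂ c₄) (haC : a₃ ≤ aC)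
    (hR : (bgSchemeOfRecord F 2 K k Ω U₀ dom levB Gp Δ2 a hposπ hposb hQ εC B₀ C₄ a₃ j a𝔄 ε₄).RegimeTok)
    (hdom : ∀ V ∈ dom, ∀ c, ‖(V c : Matrix (Fin 2) (Fin 2) ℂ) * star (Averaging.iter (avOfRecord F 2 K) k U₀ c : Matrix (Fin 2) (Fin 2) ℂ) - 1‖ ≤ 1 / 4) :
    (bgSchemeOfRecord F 2 K k Ω U₀ dom levB Gp Δ2 a hposπ hposb hQ εC B₀ C₄ a₃ j a𝔄 ε₄).ChartSUTok :=
  BgScheme.chartSUTok_of_lieTokAt fun V hV =>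
    lieTokAt_bgSchemeOfRecord_two F K k Ω U₀ dom levB a hposπ hposb hQ εC B₀ C₄ a₃ j a𝔄 ε₄ RC hCreal hCtr h hGpR hGpS hΔ2R hΔ2S hP haC (hR V hV).1 (hR V hV).2.1
      (hR V hV).2.2 (hdom V hV)

include RC hCreal hCtr in
set_option maxHeartbeats 1600000 in
/-- ★★★ **def-Y's BUNDLE `SchemeTokOfRecord` FROM `RegimeTok` AT `N = 2`**: for the (3.134) datum `Δ2` (`Delta2Tok ∧ Delta2SymmTok` — then `Δ2` is real, ✓`realConj_delta2_eq_self`, and the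
`HessSymmTok`∕`C1Tok` conjuncts are theorems, ✓`schemeTokOfRecord_of_regimeTok_of_chartSUTok`) commuting with the scalar part, a real `S`-commuting `G′`, the guard, Sect. C's displayed rows
and the domain smallness, Prop. 6's `RegimeTok` ALONE carries the bundle. [cite: Balaban1985Variational, Prop. 6 (115)–(121) p.295; Balaban1985BackgroundPropagators, (3.134) p.422] -/
theorem schemeTokOfRecord_two_of_regimeTok (h : SmallBelow (avOfRecord F 2 K) k U₀)
    (hGpR : ∀ s, Gp (starW (phiRec 2) s) = starW (phiRec 2) (Gp s)) (hGpS : ∀ s, Gp (scalPartW 2 _ s) = scalPartW 2 _ (Gp s))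
    (hΔ : Delta2Tok F 2 K k Ω U₀ levB a hposb hQ Δ2) (hs : Delta2SymmTok F 2 K k Ω U₀ Δ2) (hΔ2S : ∀ x, Δ2 (scalPartW 2 _ x) = scalPartW 2 _ (Δ2 x))
    (hP : Prop4Hyp (CslOfRecord F 2 K k Ω U₀ levB) C₂ c₄) (haC : a₃ ≤ aC)
    (hR : (bgSchemeOfRecord F 2 K k Ω U₀ dom levB Gp Δ2 a hposπ hposb hQ εC B₀ C₄ a₃ j a𝔄 ε₄).RegimeTok)
    (hdom : ∀ V ∈ dom, ∀ c, ‖(V c : Matrix (Fin 2) (Fin 2) ℂ) * star (Averaging.iter (avOfRecord F 2 K) k U₀ c : Matrix (Fin 2) (Fin 2) ℂ) - 1‖ ≤ 1 / 4) :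
    SchemeTokOfRecord F 2 K k Ω U₀ dom levB Gp Δ2 a hposπ hposb hQ εC B₀ C₄ a₃ j a𝔄 ε₄ := by
  have hΔ2R : ∀ x, Δ2 (starW (phiRec 2) x) = starW (phiRec 2) (Δ2 x) :=
    (realConj_eq_self_iff (phiRec 2) Δ2).1 (realConj_delta2_eq_self F 2 K k Ω U₀ levB a hposb hQ h hΔ hs)
  exact schemeTokOfRecord_of_regimeTok_of_chartSUTok F 2 K k Ω U₀ dom levB Gp a hposπ hposb hQ εC B₀ C₄ a₃ j a𝔄 ε₄ h hΔ hs hR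
    (chartSUTok_bgSchemeOfRecord_two F K k Ω U₀ dom levB a hposπ hposb hQ εC B₀ C₄ a₃ j a𝔄 ε₄ RC hCreal hCtr h hGpR hGpS hΔ2R hΔ2S hP haC hR hdom)

end Two

end Summit.QuantumFields.YangMills.Theorems.N07LieTokAtOfRecordTwo

end
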